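import Mathlib
import Summits.KontsevichZagierPeriods.Zeta5Search.Elimination.HalfShift
import HarnessLib

/-!
# ζ(5) search — class `elim`: THE HALF-SHIFT MEET `Π(z) ∩ Π(Hz)` (E-L19a, part 2 of 2; cell `pub-zeta5`,
# fam-elim gen 23; first half of gen-1's E-L19 ask of 2026-08-21, the 4-point cluster `{c, c + e₇, Hc, DSc}`)

HONEST FRAMING: systematic search; no irrationality claim unless certified.

OUR work (Summit side; `families/elim/FAMILY.md` §6 (E-L19a)).  For a b-chart point `z` (level `z₀`, `d(z) ≥ 0`,
`z₇ ≤ z₀`) the four points `z`, `z + e₇` (level `z₀`) and `Hz = (z₀ + 1; z + 1_{{4,5,7}})`, `Hz + e₇` (level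
`z₀ + 1`) have canonical coefficient vectors `D = (U, W, V) ∈ ℚ³` spanning two planes `Π(z) ∋ D(z), D(z + e₇)` and
`Π(Hz) ∋ D(Hz), D(Hz + e₇)`.  `dictMeet_at` is the explicit vector on their intersection, coordinatewise:
   `D₀·D(z + e₇) − A·D(z) − P·D(Hz) − Q·D(Hz + e₇) = 0`, with
   `D₀ = z₀ − 1 − z₄ − z₅ − z₇`,  `A = D₀·(z₇ + 1)(z₀ + 1 − z₇) + (z₄ + 1)(z₅ + 1)(z₇ + 1)`,
   `Q = −(2z₀ + 2 − z₁ − z₂ − z₃ − z₆)`,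
   `P = e₃ − (z₀ + 1)·e₂ + (z₀ + 1)²·e₁ − (z₀ + 1)³ + (2z₀ + 2 − e₁)(z₇ + 1)(z₀ − z₇)`
   (`eₖ` the elementary symmetric functions of `z₁, z₂, z₃, z₆`; `meetD0`, `meetA`, `meetQ`, `meetP`).
Mechanism: the creative-telescoping identity `D₀ R_{z+e₇} − A R_z − P R_{Hz} − Q R_{Hz+e₇} = G(t+1) − G(t)` with
`G(t) = g(t+1)/((t+1)_{z₀+1})⁶`, `g(x) = −(x − 1)·∏_{j ∈ T}(x + z₀ − z_j)·S_z(x)` (`meetG`), proved as a polynomial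
identity (`hrel`: `meet_core`, a pure `ring` identity in `x, z₀, …, z₇`, combined with the two Pochhammer identities
of part 1 and the cancellation of `∏_{j ∉ T}(X + z₀ + 1 − z_j) ≠ 0`), then `coeff_rel_of_summable_mixed`; the
`V`-boundary term vanishes because `(X − 1) ∣ g`.
Provenance of the closed forms: exact rational solves and tensor interpolation, fam-elim g23 `e19/probe8.py`,
`probe12.py`, `probe13.py` (`P` has 48 monomials; probe13 identity (1) held at 40/40 random rational points before
formalisation).  `D₀, A, Q` are products of affine forms, `P` is not — generically no lattice vector lies on the meet
line (`e19/probe11.out`).  Gen-1's smooth four-term BRIDGE `d_c·C(z) + d₇·C(z + e₇) + d_X·C(Hz) + d_DS·C(DSz) = 0`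
among the ELIMINANT vectors `C(x) = ρ_B(x)·D(x) ∧ D(x + e₇)` (four planes of `ℚ³`; exact at 6 points, `e19/probe9.out`,
not a theorem) is to be assembled from this meet, the second meet `Π(z + e₇) ∩ Π(Hz)` and `(DS)`
(`dictionary_dsShift`) — E-L19b/c, successor (`HOME/pub-zeta5-fam-elim/g23/E19-DESIGN.md`).
What this is NOT: anything about sizes, denominators, valuations or irrationality; the class verdict is unchanged
(T1 NO / T2 NO / T4 YES).
-/

open Finset Polynomial

namespace Summit.KontsevichZagierPeriods.Zeta5Search.Elimination

open Summit.KontsevichZagierPeriods.Zeta5Search.DualSeries (InBox numPoly eval_numPoly numPoly_update)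
open Summit.KontsevichZagierPeriods.Zeta5Search.WedgeDictionary
open Literature.NumberTheory.Transcendental
open Literature.NumberTheory.Transcendental.BallRivoal (pfEval pf_unique poch_pos harm pochPoly eval_pochPoly)

/-! ### Closed forms and the core identity -/

/-- `D₀ = z₀ − 1 − z₄ − z₅ − z₇`. -/
def meetD0 (z : ℕ → ℤ) : ℚ := (z 0 : ℚ) - 1 - z 4 - z 5 - z 7

/-- `A = D₀·(z₇ + 1)(z₀ + 1 − z₇) + (z₄ + 1)(z₅ + 1)(z₇ + 1)`. -/
def meetA (z : ℕ → ℤ) : ℚ :=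
  meetD0 z * ((z 7 : ℚ) + 1) * ((z 0 : ℚ) + 1 - z 7) + ((z 4 : ℚ) + 1) * ((z 5 : ℚ) + 1) * ((z 7 : ℚ) + 1)

/-- `Q = −(2z₀ + 2 − z₁ − z₂ − z₃ − z₆)`. -/
def meetQ (z : ℕ → ℤ) : ℚ := -(2 * (z 0 : ℚ) + 2 - z 1 - z 2 - z 3 - z 6)

/-- `P = e₃ − (z₀+1)e₂ + (z₀+1)²e₁ − (z₀+1)³ + (2z₀+2−e₁)(z₇+1)(z₀−z₇)`, `eₖ` the elementary symmetric functions of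
`z₁, z₂, z₃, z₆` (the non-product meet coordinate; 48 monomials when expanded). -/
def meetP (z : ℕ → ℤ) : ℚ :=
  ((z 1 : ℚ) * z 2 * z 3 + (z 1 : ℚ) * z 2 * z 6 + (z 1 : ℚ) * z 3 * z 6 + (z 2 : ℚ) * z 3 * z 6)
    - ((z 0 : ℚ) + 1) * ((z 1 : ℚ) * z 2 + (z 1 : ℚ) * z 3 + (z 1 : ℚ) * z 6 + (z 2 : ℚ) * z 3 + (z 2 : ℚ) * z 6 +
        (z 3 : ℚ) * z 6)
    + ((z 0 : ℚ) + 1) ^ 2 * ((z 1 : ℚ) + z 2 + z 3 + z 6) - ((z 0 : ℚ) + 1) ^ 3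
    + (2 * (z 0 : ℚ) + 2 - z 1 - z 2 - z 3 - z 6) * ((z 7 : ℚ) + 1) * ((z 0 : ℚ) - z 7)

/-- `∏_{j ∈ T} (x + z₀ − z_j)` (the telescoper's moving factor). -/
def t3Eval (z : ℕ → ℤ) (x : ℚ) : ℚ := (x + (z 0 - z 4)) * (x + (z 0 - z 5)) * (x + (z 0 - z 7))

/-- **The core identity of the meet** (a polynomial identity in `x, z₀, …, z₇`; found by exact rational interpolation,
fam-elim g23 `e19/probe8,12,13`, and certified here by `ring`). -/
theorem meet_core (z : ℕ → ℤ) (x : ℚ) :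
    meetD0 z * ((x + z 7) * (x + (z 0 - z 7))) * (2 * x + z 0) * pcStar z x
      - meetA z * (2 * x + z 0) * pcStar z x
      - (meetP z + meetQ z * ((x + (z 7 + 1)) * (x + (z 0 - z 7)))) * (2 * x + z 0 + 1) * (x + z 0 + 1) * ptStar z x
      + (x + z 0 + 1) * zAll z x - (x - 1) * t3Eval z x * pcStar z x = 0 := by
  unfold meetA meetD0 meetP meetQ pcStar ptStar zAll t3Eval
  ring

/-! ### The telescoper and the cancelling factor as polynomials -/
/-- `∏_{j ∈ T}(X + z₀ − z_j)`. -/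
noncomputable def t3Poly (z : ℕ → ℤ) : ℚ[X] :=
  (X + C ((z 0 - z 4 : ℤ) : ℚ)) * (X + C ((z 0 - z 5 : ℤ) : ℚ)) * (X + C ((z 0 - z 7 : ℤ) : ℚ))

/-- The telescoper numerator `g(X) = −(X − 1)·∏_{j∈T}(X + z₀ − z_j)·S_z(X)`:
the meet relation is `Σ cᵢ R_{bᵢ}(t) = G(t+1) − G(t)` with `G(t) = g(t+1)/((t+1)_{z₀+1})⁶`. -/
noncomputable def meetG (z : ℕ → ℤ) : ℚ[X] := -((X - C 1) * t3Poly z * slotPoly z)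

/-- `g(x) = −(x − 1)·T₃(x)·S_z(x)`. -/
theorem eval_meetG (z : ℕ → ℤ) (x : ℚ) : (meetG z).eval x = -((x - 1) * t3Eval z x * slotEval z x) := by
  unfold meetG t3Poly t3Eval
  simp only [eval_neg, eval_mul, eval_sub, eval_add, eval_X, eval_C, eval_slotPoly]
  push_cast
  ring

/-- `deg g ≤ 4 + 2 Σ_j z_j`. -/
theorem natDegree_meetG_le (z : ℕ → ℤ) : (meetG z).natDegree ≤ 4 + ∑ j ∈ range 7, 2 * (z (j + 1)).toNat := by
  unfold meetG
  rw [natDegree_neg]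
  have h1 : (X - C (1 : ℚ)).natDegree ≤ 1 := (natDegree_X_sub_C _).le
  have h3 : (t3Poly z).natDegree ≤ 3 := by
    unfold t3Poly
    refine natDegree_mul_le.trans ?_
    have := natDegree_mul_le (p := X + C ((z 0 - z 4 : ℤ) : ℚ)) (q := X + C ((z 0 - z 5 : ℤ) : ℚ))
    have a := (natDegree_X_add_C ((z 0 - z 4 : ℤ) : ℚ)).le
    have b := (natDegree_X_add_C ((z 0 - z 5 : ℤ) : ℚ)).le
    have c := (natDegree_X_add_C ((z 0 - z 7 : ℤ) : ℚ)).le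
    omega
  have hs := natDegree_slotPoly_le z
  have := natDegree_mul_le (p := (X - C (1 : ℚ)) * t3Poly z) (q := slotPoly z)
  have := natDegree_mul_le (p := X - C (1 : ℚ)) (q := t3Poly z)
  omega

/-- `∏_{j ∉ T}(X + z₀ + 1 − z_j)` (a non-zero polynomial; used to cancel). -/
noncomputable def pcPoly (z : ℕ → ℤ) : ℚ[X] :=
  (X + C ((z 0 + 1 - z 1 : ℤ) : ℚ)) * (X + C ((z 0 + 1 - z 2 : ℤ) : ℚ)) * (X + C ((z 0 + 1 - z 3 : ℤ) : ℚ)) *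
    (X + C ((z 0 + 1 - z 6 : ℤ) : ℚ))

/-- `pcPoly` evaluates to `pcStar`. -/
theorem eval_pcPoly (z : ℕ → ℤ) (x : ℚ) : (pcPoly z).eval x = pcStar z x := by
  unfold pcPoly pcStar
  simp only [eval_mul, eval_add, eval_X, eval_C]
  push_cast
  ring

/-- `pcPoly z ≠ 0`. -/
theorem pcPoly_ne_zero (z : ℕ → ℤ) : pcPoly z ≠ 0 := by
  unfold pcPoly
  exact mul_ne_zero (mul_ne_zero (mul_ne_zero (X_add_C_ne_zero _) (X_add_C_ne_zero _)) (X_add_C_ne_zero _))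
    (X_add_C_ne_zero _)

/-! ### The theorem -/

set_option maxHeartbeats 800000 in
/-- **Dictionary, half-shift meet (E-L19a).**  For an integer point `z` of the b-chart box with `d(z) ≥ 0` and
`z₇ ≤ z₀`, the canonical coefficients `ω ∈ {U, W, V}` of the four points `z`, `z + e₇` (level `z₀`) and
`Hz = (z₀+1; z + 1_{{4,5,7}})`, `Hz + e₇` (level `z₀ + 1`) satisfy one explicit four-term relation
`D₀·ω(z+e₇) − A·ω(z) − P·ω(Hz) − Q·ω(Hz+e₇) = 0` with the closed forms `meetD0, meetA, meetP, meetQ`: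
the two planes `Π(z) ∋ D(z), D(z+e₇)` and `Π(Hz) ∋ D(Hz), D(Hz+e₇)` of `ℚ³` meet in the line spanned by
`D₀·D(z+e₇) − A·D(z) = P·D(Hz) + Q·D(Hz+e₇)`. -/
theorem dictMeet_at (z : ℕ → ℤ) (hz : InBox z) (hd : 0 ≤ dOf z) (h7 : z 7 ≤ z 0) :
    (meetD0 z * coeffU (bump z 6) - meetA z * coeffU z - meetP z * coeffU (hShift z) -
          meetQ z * coeffU (bump (hShift z) 6) = 0 ∧
      meetD0 z * coeffW (bump z 6) - meetA z * coeffW z - meetP z * coeffW (hShift z) -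
          meetQ z * coeffW (bump (hShift z) 6) = 0) ∧
      meetD0 z * coeffV (bump z 6) - meetA z * coeffV z - meetP z * coeffV (hShift z) -
          meetQ z * coeffV (bump (hShift z) 6) = 0 := by
  set N := (z 0).toNat with hN
  have hN0 : ((N : ℕ) : ℤ) = z 0 := by rw [hN]; exact Int.toNat_of_nonneg hz.1
  have hNq : ((N : ℕ) : ℚ) = (z 0 : ℚ) := by exact_mod_cast hN0
  have hz7 : 0 ≤ z 7 := (hz.2 6 (by simp)).1
  -- the four points are admissible
  obtain ⟨hb7, hs7⟩ := box_update z hz hd (show 6 ∈ range 7 by simp) h7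
  have hK : InBox (hShift z) := inBox_hShift z hz
  have hdK : 0 ≤ dOf (hShift z) := by rw [dOf_hShift]; exact hd
  have h7K : hShift z (6 + 1) ≤ hShift z 0 := by
    rw [show (6 : ℕ) + 1 = 7 from rfl, hShift_seven, hShift_zero]; omega
  obtain ⟨hbK7, hsK7⟩ := box_update (hShift z) hK hdK (show 6 ∈ range 7 by simp) h7K
  have hNK : (hShift z 0).toNat = N + 1 := by rw [hShift_zero]; omega
  have hNK7 : (bump (hShift z) 6 0).toNat = N + 1 := by rw [bump_zero, hShift_zero]; omega
  have hN7 : (bump z 6 0).toNat = N := by rw [bump_zero]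
  -- degree of the telescoper
  have hg : (meetG z).natDegree + 1 ≤ 6 * (N + 1) := by
    have h1 := natDegree_meetG_le z
    have hs : ((∑ j ∈ range 7, 2 * (z (j + 1)).toNat : ℕ) : ℤ) = 2 * ∑ j ∈ range 7, z (j + 1) := by
      push_cast
      rw [mul_sum]
      exact sum_congr rfl fun j hj => by rw [Int.toNat_of_nonneg (hz.2 j hj).1]
    unfold dOf at hd
    omega
  -- the numerator identity
  have e7 : numPoly (bump z 6) = numPoly z * ((X + C (z 7 : ℚ)) * (X + C ((z 0 - z 7 : ℤ) : ℚ))) :=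
    numPoly_update z (show 6 ∈ range 7 by simp) hz7
  have eK7 : numPoly (bump (hShift z) 6) =
      numPoly (hShift z) * ((X + C (hShift z 7 : ℚ)) * (X + C ((hShift z 0 - hShift z 7 : ℤ) : ℚ))) :=
    numPoly_update (hShift z) (show 6 ∈ range 7 by simp) (by rw [show (6 : ℕ) + 1 = 7 from rfl, hShift_seven]; omega)
  have hrel : C (-meetP z) * numPoly (hShift z) + C (-meetQ z) * numPoly (bump (hShift z) 6) +
        C (-meetA z) * (numPoly z * (X + C ((N + 1 : ℕ) : ℚ)) ^ 6) +
        C (meetD0 z) * (numPoly (bump z 6) * (X + C ((N + 1 : ℕ) : ℚ)) ^ 6) =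
      (meetG z).comp (X + C 1) * X ^ 6 - meetG z * (X + C ((N + 1 : ℕ) : ℚ)) ^ 6 := by
    rw [← sub_eq_zero]
    refine (mul_eq_zero.1 ?_).resolve_left (pcPoly_ne_zero z)
    apply Polynomial.funext
    intro x
    -- `Pc, PT, ∏(x+z_j), ∏(x+z₀+1−z_j), T₃, S_z(x), S_z(x+1), numPoly_{Hz}(x)` stay atoms: the combination is formal
    have hK' := eval_numPoly_hShift_mul z hz x
    have hS := slotEval_shift_mul z hz x
    have hcore := meet_core z x
    have hT : t3Eval z (x + 1) * pcStar z x = nAll z x := by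
      unfold t3Eval pcStar nAll; ring
    rw [e7, eK7]
    simp only [eval_mul, eval_sub, eval_add, eval_pow, eval_comp, eval_C, eval_X, eval_zero, eval_pcPoly,
      hShift_zero, hShift_seven]
    rw [eval_numPoly_slotEval z x, eval_meetG z x, eval_meetG z (x + 1)]
    push_cast
    rw [hNq]
    linear_combination (-(meetP z + meetQ z * ((x + (z 7 + 1)) * (x + (z 0 - z 7))))) * hK' + hS +
      (x ^ 7 * slotEval z (x + 1)) * hT + (slotEval z x * (x + z 0 + 1) ^ 6) * hcore
  have main := coeff_rel_of_summable_mixed (hShift z) (bump (hShift z) 6) z (bump z 6) N hK hbK7 hz hb7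
    (sum_le_of_dOf _ hdK) hsK7 (sum_le_of_dOf _ hd) hs7 hNK hNK7 rfl hN7
    (-meetP z) (-meetQ z) (-meetA z) (meetD0 z) (meetG z) hg hrel
  obtain ⟨⟨hU, hW⟩, hV⟩ := main
  have hg1 : (meetG z).eval 1 = 0 := by rw [eval_meetG]; ring
  rw [hg1, zero_div] at hV
  exact ⟨⟨by linear_combination hU, by linear_combination hW⟩, by linear_combination hV⟩

end Summit.KontsevichZagierPeriods.Zeta5Search.Elimination
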